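import Summits.HubbardSuperconductivity.HubbardSuperconductivity.Theses.DeformationLadder
import Summits.HubbardSuperconductivity.HubbardSuperconductivity.Theorems.BalabanIRBirEveryGroundStateSchur

/-!
# `DeformedRung` (stmt-HubbardSuperconductivity-1894, route `DeformationLadder`) — the Griffiths step

Finite-size convexity bookkeeping for the number-conserving deformation family
`K_L(U,g) = hubbardTorus 2 L 1 U - (g/L²) • P`, `P = pFᴴ pF`, `pF = pairField dWaveFormFactor L`,
in the canonical sector `(N, S^z = 0)`:

* `deformed_chord_le_lro`: for `g' < g` and a normalised sector ground state `φ` of `K_L(U,g)`,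
  `(E_L(g') - E_L(g)) / ((g - g')/L²) ≤ re ⟨φ, P φ⟩` (`E_L = minEnergyOn · (szSector N 0)`): the
  variational principle for `K(g') = K(g) + ((g - g')/L²) • P` at the trial vector `φ` — the
  super-gradient inequality of the concave sector energy `g ↦ E_L(g)` (Griffiths 1964; Kato 1966
  II-§5.4), one-sided, so no Hermiticity is used.
* `lro_ge_of_deformed_chord`: the same as a lower bound on the LRO density
  `re ⟨φ, P φ⟩ / L⁴ ≥ (E_L(g') - E_L(g)) / ((g - g') L²)`.
* `everyGS_lro_of_eventual_chord`: if `E_L(g') - E_L(g) ≥ c L²` (`c > 0`) at all large `L` in the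
  sectors `N_L = 2⌊(1-δ)L²/2⌋`, then EVERY normalised sector ground state of `K_L(U,g)` has LRO
  density `≥ c/(g - g')` at all large `L` — literally the inner block
  `∃ a > 0, ∃ L₀, ∀ L ≥ L₀, ∀ φ, …` of `DeformedRung`.
* `everyGS_lro_of_tendsto`: the same from thermodynamic limits `L⁻²E_L(g) → e`, `L⁻²E_L(g') → e'`
  with `e < e'` (Griffiths' lemma: the LRO of every ground-state sequence is bounded below by the
  left chord slope of the limiting energy density).

What remains for `DeformedRung` after this file is purely thermodynamic: the existence and the
value `inf_{h ≥ 0}[ẽ_U(h) + h²/g]` of `lim L⁻²E_L(g)` (items `ApproximatingHamiltonianGC` + ensemble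
equivalence) and the strict left chord `e(g') - e(g) ≥ c (g - g')` (items `FreeCooperLogarithm`,
`EnergySandwich` and the Danskin step).

Sources: R. B. Griffiths, J. Math. Phys. 5 (1964) 1215 (slopes of convex thermodynamic functions
control order parameters of every state); T. Kato, *Perturbation Theory for Linear Operators*
(1966) II-§5.4; T. A. Kaplan, P. Horsch, W. von der Linden, J. Phys. Soc. Jpn. 58 (1989) 3894
(the finite-size two-line form); H. Tasaki, *Physics and Mathematics of Quantum Many-Body Systems*
(2020) §2.1 (variational principle). No definition is introduced.
-/

-- the mandated namespace `Summit.<Summit>.<Problem>.Theorems` repeats `HubbardSuperconductivity`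
-- (single-problem summit, D-0017), which the `dupNamespace` linter flags on every declaration
set_option linter.dupNamespace false

noncomputable section

namespace Summit.HubbardSuperconductivity.HubbardSuperconductivity.Theorems.DeformationLadder

open Matrix Filter Topology Literature.MathematicalPhysics.QuantumLattice

/-! ### Fixed side `L`, fixed sector -/

section Pointwise

variable (L : ℕ) [NeZero L]

/-- The family is affine in `g`: `K(g') = K(g) + ((g - g')/L²) • P`. [folklore] -/
theorem deformed_eq_add_smul (U g g' : ℝ) :
    hubbardTorus 2 L 1 U - ((g' / (L : ℝ) ^ 2 : ℝ) : ℂ) •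
        (Matrix.conjTranspose (pairField dWaveFormFactor L) * pairField dWaveFormFactor L) =
      hubbardTorus 2 L 1 U - ((g / (L : ℝ) ^ 2 : ℝ) : ℂ) •
          (Matrix.conjTranspose (pairField dWaveFormFactor L) * pairField dWaveFormFactor L) +
        (((g - g') / (L : ℝ) ^ 2 : ℝ) : ℂ) •
          (Matrix.conjTranspose (pairField dWaveFormFactor L) * pairField dWaveFormFactor L) := by
  have hc : ((g' / (L : ℝ) ^ 2 : ℝ) : ℂ) =
      ((g / (L : ℝ) ^ 2 : ℝ) : ℂ) - (((g - g') / (L : ℝ) ^ 2 : ℝ) : ℂ) := by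
    push_cast; ring
  rw [hc, sub_smul]
  abel

/-- **Chord inequality along the deformation family** (super-gradient of the concave sector
energy). For `g' < g` and a normalised `(N, S^z = 0)`-sector ground state `φ` of
`K_L(U,g) = H_L - (g/L²) • P`:
`(minEnergyOn K_L(U,g') - minEnergyOn K_L(U,g)) / ((g - g')/L²) ≤ re ⟨φ, P φ⟩`, because
`minEnergyOn K(g') ≤ re ⟨φ, K(g') φ⟩ = minEnergyOn K(g) + ((g - g')/L²) re ⟨φ, P φ⟩`.
Griffiths, J. Math. Phys. 5 (1964) 1215; Kato (1966) II-§5.4; Tasaki (2020) §2.1. [folklore] -/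
theorem deformed_chord_le_lro (U : ℝ) (N : ℕ) {g g' : ℝ} (hg : g' < g)
    {φ : Fock (Orb (FermionTorus 2 L))} (hφ1 : star φ ⬝ᵥ φ = 1)
    (hφ : IsGroundStateInSector (hubbardTorus 2 L 1 U - ((g / (L : ℝ) ^ 2 : ℝ) : ℂ) •
      (Matrix.conjTranspose (pairField dWaveFormFactor L) * pairField dWaveFormFactor L)) N 0 φ) :
    ((hubbardTorus 2 L 1 U - ((g' / (L : ℝ) ^ 2 : ℝ) : ℂ) •
          (Matrix.conjTranspose (pairField dWaveFormFactor L) * pairField dWaveFormFactor L)).minEnergyOn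
          (szSector N 0) -
        (hubbardTorus 2 L 1 U - ((g / (L : ℝ) ^ 2 : ℝ) : ℂ) •
          (Matrix.conjTranspose (pairField dWaveFormFactor L) * pairField dWaveFormFactor L)).minEnergyOn
          (szSector N 0)) / ((g - g') / (L : ℝ) ^ 2) ≤
      (star φ ⬝ᵥ (Matrix.conjTranspose (pairField dWaveFormFactor L) * pairField dWaveFormFactor L) *ᵥ
        φ).re := by
  have hL : (0 : ℝ) < (L : ℝ) := Nat.cast_pos.2 (Nat.pos_of_ne_zero (NeZero.ne L))
  have hκ : 0 < (g - g') / (L : ℝ) ^ 2 := div_pos (sub_pos.2 hg) (by positivity)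
  obtain ⟨hmem, -, heig⟩ := hφ
  rw [deformed_eq_add_smul L U g g']
  exact chord_div_le_re_expect_of_eigen _ _ (szSector N 0) hκ hmem hφ1 heig

/-- **LRO density of a deformed ground state from a chord of the sector energy.** For `g' < g`
and a normalised sector ground state `φ` of `K_L(U,g)`:
`(minEnergyOn K_L(U,g') - minEnergyOn K_L(U,g)) / ((g - g') L²) ≤ re ⟨φ, P φ⟩ / L⁴`.
Griffiths, J. Math. Phys. 5 (1964) 1215; Kaplan–Horsch–von der Linden (1989). [folklore] -/
theorem lro_ge_of_deformed_chord (U : ℝ) (N : ℕ) {g g' : ℝ} (hg : g' < g)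
    {φ : Fock (Orb (FermionTorus 2 L))} (hφ1 : star φ ⬝ᵥ φ = 1)
    (hφ : IsGroundStateInSector (hubbardTorus 2 L 1 U - ((g / (L : ℝ) ^ 2 : ℝ) : ℂ) •
      (Matrix.conjTranspose (pairField dWaveFormFactor L) * pairField dWaveFormFactor L)) N 0 φ) :
    ((hubbardTorus 2 L 1 U - ((g' / (L : ℝ) ^ 2 : ℝ) : ℂ) •
          (Matrix.conjTranspose (pairField dWaveFormFactor L) * pairField dWaveFormFactor L)).minEnergyOn
          (szSector N 0) -
        (hubbardTorus 2 L 1 U - ((g / (L : ℝ) ^ 2 : ℝ) : ℂ) •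
          (Matrix.conjTranspose (pairField dWaveFormFactor L) * pairField dWaveFormFactor L)).minEnergyOn
          (szSector N 0)) / ((g - g') * (L : ℝ) ^ 2) ≤
      (expect (Matrix.conjTranspose (pairField dWaveFormFactor L) * pairField dWaveFormFactor L) φ).re /
        (L : ℝ) ^ 4 := by
  have hL : (0 : ℝ) < (L : ℝ) := Nat.cast_pos.2 (Nat.pos_of_ne_zero (NeZero.ne L))
  have hL2 : (0 : ℝ) < (L : ℝ) ^ 2 := by positivity
  have hL4 : (0 : ℝ) < (L : ℝ) ^ 4 := by positivity
  have hgg : 0 < g - g' := sub_pos.2 hg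
  have key := deformed_chord_le_lro L U N hg hφ1 hφ
  rw [div_div_eq_mul_div, div_le_iff₀ hgg] at key
  rw [expect, div_le_div_iff₀ (mul_pos hgg hL2) hL4]
  calc _ = ((hubbardTorus 2 L 1 U - ((g' / (L : ℝ) ^ 2 : ℝ) : ℂ) •
          (Matrix.conjTranspose (pairField dWaveFormFactor L) * pairField dWaveFormFactor L)).minEnergyOn
          (szSector N 0) -
        (hubbardTorus 2 L 1 U - ((g / (L : ℝ) ^ 2 : ℝ) : ℂ) •
          (Matrix.conjTranspose (pairField dWaveFormFactor L) * pairField dWaveFormFactor L)).minEnergyOn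
          (szSector N 0)) * (L : ℝ) ^ 2 * (L : ℝ) ^ 2 := by ring
    _ ≤ (star φ ⬝ᵥ (Matrix.conjTranspose (pairField dWaveFormFactor L) * pairField dWaveFormFactor L) *ᵥ
        φ).re * (g - g') * (L : ℝ) ^ 2 := mul_le_mul_of_nonneg_right key hL2.le
    _ = _ := by ring

end Pointwise

/-! ### Every ground state, all large sides -/

/-- **Every-ground-state LRO from an eventual chord of order `L²`.** If for some `g' < g` and
`c > 0` the sector energies in the sectors `N_L = 2⌊(1-δ)L²/2⌋` satisfy
`minEnergyOn K_L(U,g') - minEnergyOn K_L(U,g) ≥ c L²` at all large `L`, then every normalised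
sector ground state of `K_L(U,g)` has `d`-wave LRO density `≥ c/(g - g')` at all large `L` —
the inner block of `DeformedRung`. Griffiths, J. Math. Phys. 5 (1964) 1215. [folklore] -/
theorem everyGS_lro_of_eventual_chord (U δ : ℝ) {g g' c : ℝ} (hg : g' < g) (hc : 0 < c)
    (h : ∃ L₁ : ℕ, ∀ (L : ℕ) [NeZero L], L₁ ≤ L →
      c * (L : ℝ) ^ 2 ≤
        (hubbardTorus 2 L 1 U - ((g' / (L : ℝ) ^ 2 : ℝ) : ℂ) •
            (Matrix.conjTranspose (pairField dWaveFormFactor L) * pairField dWaveFormFactor L)).minEnergyOn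
            (szSector (2 * ⌊(1 - δ) * (L : ℝ) ^ 2 / 2⌋₊) 0) -
          (hubbardTorus 2 L 1 U - ((g / (L : ℝ) ^ 2 : ℝ) : ℂ) •
            (Matrix.conjTranspose (pairField dWaveFormFactor L) * pairField dWaveFormFactor L)).minEnergyOn
            (szSector (2 * ⌊(1 - δ) * (L : ℝ) ^ 2 / 2⌋₊) 0)) :
    ∃ a : ℝ, 0 < a ∧ ∃ L₀ : ℕ, ∀ (L : ℕ) [NeZero L], L₀ ≤ L →
      ∀ φ : Fock (Orb (FermionTorus 2 L)), star φ ⬝ᵥ φ = 1 →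
        IsGroundStateInSector (hubbardTorus 2 L 1 U - ((g / (L : ℝ) ^ 2 : ℝ) : ℂ) •
          (Matrix.conjTranspose (pairField dWaveFormFactor L) * pairField dWaveFormFactor L))
          (2 * ⌊(1 - δ) * (L : ℝ) ^ 2 / 2⌋₊) 0 φ →
        a ≤ (expect (Matrix.conjTranspose (pairField dWaveFormFactor L) *
          pairField dWaveFormFactor L) φ).re / (L : ℝ) ^ 4 := by
  obtain ⟨L₁, h⟩ := h
  have hgg : 0 < g - g' := sub_pos.2 hg
  refine ⟨c / (g - g'), div_pos hc hgg, L₁, fun L _ hL₁L φ hφ1 hφ => ?_⟩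
  have hL : (0 : ℝ) < (L : ℝ) := Nat.cast_pos.2 (Nat.pos_of_ne_zero (NeZero.ne L))
  have hL2 : (0 : ℝ) < (L : ℝ) ^ 2 := by positivity
  have key := lro_ge_of_deformed_chord L U _ hg hφ1 hφ
  refine le_trans ?_ key
  rw [div_le_div_iff₀ hgg (mul_pos hgg hL2)]
  calc c * ((g - g') * (L : ℝ) ^ 2) = c * (L : ℝ) ^ 2 * (g - g') := by ring
    _ ≤ _ := mul_le_mul_of_nonneg_right (h L hL₁L) hgg.le

/-- **Griffiths' lemma for the deformation family.** If the sector energy densities converge,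
`E_{L}(g)/L² → e` and `E_{L}(g')/L² → e'` along `L → ∞` (sides `L + 1`, sectors
`N_L = 2⌊(1-δ)L²/2⌋`), for some `g' < g` with `e < e'`, then every normalised sector ground state
of `K_L(U,g)` has `d`-wave LRO density `≥ a := (e' - e)/(2(g - g')) > 0` at all large `L`: the LRO
of every ground-state sequence is bounded below by the left chord slope of the limiting (concave)
energy density. Griffiths, J. Math. Phys. 5 (1964) 1215; Kato (1966) II-§5.4. [folklore] -/
theorem everyGS_lro_of_tendsto (U δ : ℝ) {g g' e e' : ℝ} (hg : g' < g) (he : e < e')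
    (hlim : Tendsto (fun L : ℕ =>
      (hubbardTorus 2 (L + 1) 1 U - ((g / ((L + 1 : ℕ) : ℝ) ^ 2 : ℝ) : ℂ) •
          (Matrix.conjTranspose (pairField dWaveFormFactor (L + 1)) *
            pairField dWaveFormFactor (L + 1))).minEnergyOn
          (szSector (2 * ⌊(1 - δ) * ((L + 1 : ℕ) : ℝ) ^ 2 / 2⌋₊) 0) / ((L + 1 : ℕ) : ℝ) ^ 2)
      atTop (𝓝 e))
    (hlim' : Tendsto (fun L : ℕ =>
      (hubbardTorus 2 (L + 1) 1 U - ((g' / ((L + 1 : ℕ) : ℝ) ^ 2 : ℝ) : ℂ) •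
          (Matrix.conjTranspose (pairField dWaveFormFactor (L + 1)) *
            pairField dWaveFormFactor (L + 1))).minEnergyOn
          (szSector (2 * ⌊(1 - δ) * ((L + 1 : ℕ) : ℝ) ^ 2 / 2⌋₊) 0) / ((L + 1 : ℕ) : ℝ) ^ 2)
      atTop (𝓝 e')) :
    ∃ a : ℝ, 0 < a ∧ ∃ L₀ : ℕ, ∀ (L : ℕ) [NeZero L], L₀ ≤ L →
      ∀ φ : Fock (Orb (FermionTorus 2 L)), star φ ⬝ᵥ φ = 1 →
        IsGroundStateInSector (hubbardTorus 2 L 1 U - ((g / (L : ℝ) ^ 2 : ℝ) : ℂ) •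
          (Matrix.conjTranspose (pairField dWaveFormFactor L) * pairField dWaveFormFactor L))
          (2 * ⌊(1 - δ) * (L : ℝ) ^ 2 / 2⌋₊) 0 φ →
        a ≤ (expect (Matrix.conjTranspose (pairField dWaveFormFactor L) *
          pairField dWaveFormFactor L) φ).re / (L : ℝ) ^ 4 := by
  -- the chord `(E_L(g') - E_L(g))/L²` is eventually `≥ (e' - e)/2`
  have hc : 0 < (e' - e) / 2 := by linarith
  have hsub := hlim'.sub hlim
  have hev : ∀ᶠ L : ℕ in atTop, (e' - e) / 2 <
      (hubbardTorus 2 (L + 1) 1 U - ((g' / ((L + 1 : ℕ) : ℝ) ^ 2 : ℝ) : ℂ) •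
          (Matrix.conjTranspose (pairField dWaveFormFactor (L + 1)) *
            pairField dWaveFormFactor (L + 1))).minEnergyOn
          (szSector (2 * ⌊(1 - δ) * ((L + 1 : ℕ) : ℝ) ^ 2 / 2⌋₊) 0) / ((L + 1 : ℕ) : ℝ) ^ 2 -
      (hubbardTorus 2 (L + 1) 1 U - ((g / ((L + 1 : ℕ) : ℝ) ^ 2 : ℝ) : ℂ) •
          (Matrix.conjTranspose (pairField dWaveFormFactor (L + 1)) *
            pairField dWaveFormFactor (L + 1))).minEnergyOn
          (szSector (2 * ⌊(1 - δ) * ((L + 1 : ℕ) : ℝ) ^ 2 / 2⌋₊) 0) / ((L + 1 : ℕ) : ℝ) ^ 2 :=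
    hsub.eventually (lt_mem_nhds (by linarith))
  obtain ⟨L₁, hL₁⟩ := eventually_atTop.1 hev
  refine everyGS_lro_of_eventual_chord U δ hg hc ⟨L₁ + 1, fun L _ hL => ?_⟩
  obtain ⟨M, rfl⟩ : ∃ M, L = M + 1 := ⟨L - 1, (Nat.sub_add_cancel (by omega)).symm⟩
  have hM : L₁ ≤ M := by omega
  have key := (hL₁ M hM).le
  have hL : (0 : ℝ) < ((M + 1 : ℕ) : ℝ) := Nat.cast_pos.2 (Nat.succ_pos M)
  have hL2 : (0 : ℝ) < ((M + 1 : ℕ) : ℝ) ^ 2 := by positivity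
  rw [← sub_div, le_div_iff₀ hL2] at key
  exact key

end Summit.HubbardSuperconductivity.HubbardSuperconductivity.Theorems.DeformationLadder
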